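import Summits.NavierStokesRegularity.NavierStokesRegularity.Theses.AxisymmetricExtremality
import Literature.Analysis.FluidPDE.Seregin2020AncientLimitSymmetry
import Literature.Analysis.FluidPDE.NSBoundedInteriorRegularityProofs
import HarnessLib

/-!
# Seregin 2020, proof of Thm 2.1, (2.12): the swirl `Γ = ϱ u_φ` of the blow-up limit is
# continuous near every REGULAR point of the axis and vanishes on the axis there

Helper toward the stub `stub_seregin2020TypeII` of the crux `AxisymmetricKatoGlobal` (= the named
fact `Literature.Analysis.FluidPDE.Seregin2020_axisymmetricSingularPoint_typeII`, G. Seregin,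
Anal. Math. Phys. 10 (2020) Paper 46 = arXiv:2006.04140, Thm 2.1). About the ancient limit
`(u, p)` of the rescaled solutions the printed proof records (arXiv p. 7–8): the singular set
`S^Γ` of `Γ = ϱ u_φ` is a closed subset of the axis of symmetry, "any spatial derivatives of `Γ`
are Hölder continuous" off `S^Γ`, "`Γ(0, x₃, t) = 0` if `-R² < t < 0`, `-2R < x₃ < 2R` and
`(0, x₃, t) ∉ S^Γ_t`", and (2.12) "`Γ(x, t) → 0` as `x' → 0`" at such points. This file proves
the local statement behind these sentences for a pair `(w, π)` which is a suitable weak solution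
in every `Q(a)`, `a > 0` (property (𝒜)(i) of the limit, `exists_ancientLimit_isAxisymmetric`)
with axisymmetric slices ((𝒜)(ii)): at every regular point `z = (t, x)` of `w` with `t < 0`
and `x` on the axis, `w` has a representative `V` on a centred parabolic cylinder `Q*_r(z)`,
`r > 0`, which is continuous there (the accepted interior regularity of essentially bounded
solutions, `NSBoundedInteriorContinuity_holds`, Seregin–Šverák 2009 §2 p. 8), pointwise
axisymmetric there (a.e. symmetry upgrades to every point for continuous functions, the
space–time rotations preserving Lebesgue measure and the cylinders about axis points), whose
swirl `Γ = swirl (V t) = x₀V₁ - x₁V₀` is continuous on `Q*_r(z)` and vanishes at its axis points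
(`exists_axisymmetricRepr_of_isRegularPoint`; registered ∀-form
`swirl_continuous_zero_at_regular_axis_point`).

## References

* G. Seregin, Anal. Math. Phys. 10 (2020), Paper 46 = arXiv:2006.04140, proof of Thm. 2.1,
  structure of the limit and (2.12). [Seregin2020]
* G. Seregin, V. Šverák, Comm. PDE 34 (2009) 171–201 = arXiv:0804.1803, §2 p. 8 (interior
  regularity of bounded solutions). [SereginSverak2009]
-/

-- the problem directory repeats the summit name (D-0017); core's `dupNamespace` linter fires
set_option linter.dupNamespace false

noncomputable section

open MeasureTheory Set Function Filter Topology TopologicalSpace Metric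
open scoped NNReal ENNReal

namespace Summit.NavierStokesRegularity.NavierStokesRegularity.Theorems.AxisymmetricKatoGlobal.EulerScaling

open Literature.Analysis.FluidPDE Literature.Analysis.FluidPDE.Seregin2020

/-! ### Geometry: a backward cylinder hanging over an interior point -/

/-- The centred cylinder `Q*_{R/2}(z)` lies in the backward cylinder
`Q((t + R²/2, x), R) = ]t - R²/2, t + R²/2[ × B(x, R)` hanging from the later top time
`t + R²/2`, `z = (t, x)`. [folklore] -/
theorem parabolicCylinderCentered_half_subset_shifted {R : ℝ} (hR : 0 < R)
    (z : ℝ × EuclideanSpace ℝ (Fin 3)) :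
    parabolicCylinderCentered (R / 2) z ⊆ parabolicCylinder R (z.1 + R ^ 2 / 2, z.2) := by
  intro q hq
  rw [mem_parabolicCylinderCentered] at hq
  rw [mem_parabolicCylinder]
  obtain ⟨⟨h1, h2⟩, h3⟩ := hq
  refine ⟨⟨?_, ?_⟩, ?_⟩
  · dsimp only at h1 ⊢
    nlinarith
  · dsimp only at h2 ⊢
    nlinarith
  · dsimp only at h3 ⊢
    linarith

/-- The backward cylinder `Q((t + R²/2, x), R)` lies in the centred cylinder `Q*_{r₀}(z)` as
soon as `0 < R ≤ r₀`. [folklore] -/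
theorem parabolicCylinder_shifted_subset_centered {R r₀ : ℝ} (hR : 0 < R) (hRr : R ≤ r₀)
    (z : ℝ × EuclideanSpace ℝ (Fin 3)) :
    parabolicCylinder R (z.1 + R ^ 2 / 2, z.2) ⊆ parabolicCylinderCentered r₀ z := by
  intro q hq
  rw [mem_parabolicCylinder] at hq
  rw [mem_parabolicCylinderCentered]
  obtain ⟨⟨h1, h2⟩, h3⟩ := hq
  dsimp only at h1 h2 h3
  have hRR : R ^ 2 ≤ r₀ ^ 2 := pow_le_pow_left₀ hR.le hRr 2
  refine ⟨⟨?_, ?_⟩, ?_⟩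
  · nlinarith
  · nlinarith
  · linarith

/-- The backward cylinder `Q((t + R²/2, x), R)` with `0 < R ≤ 1`, `R ≤ -t` lies in the cylinder
`Q(a) = ]-a², 0[ × B(0, a)` about the origin of radius `a = ‖x‖ + 2 - t`. [folklore] -/
theorem parabolicCylinder_shifted_subset_zero {R : ℝ} {z : ℝ × EuclideanSpace ℝ (Fin 3)}
    (hR : 0 < R) (hR1 : R ≤ 1) (hRt : R ≤ -z.1) :
    parabolicCylinder R (z.1 + R ^ 2 / 2, z.2) ⊆
      parabolicCylinder (‖z.2‖ + 2 - z.1) (0 : ℝ × EuclideanSpace ℝ (Fin 3)) := by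
  intro q hq
  rw [mem_parabolicCylinder] at hq
  rw [mem_parabolicCylinder]
  obtain ⟨⟨h1, h2⟩, h3⟩ := hq
  dsimp only at h1 h2 h3
  simp only [Prod.fst_zero, Prod.snd_zero, dist_zero_right]
  have hR2 : R ^ 2 ≤ R := by nlinarith
  have hn : 0 ≤ ‖z.2‖ := norm_nonneg _
  have ha1 : 1 ≤ ‖z.2‖ + 2 - z.1 := by linarith
  have haa : ‖z.2‖ + 2 - z.1 ≤ (‖z.2‖ + 2 - z.1) ^ 2 := by nlinarith
  refine ⟨⟨by linarith, by linarith⟩, ?_⟩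
  calc ‖q.2‖ = dist q.2 0 := (dist_zero_right _).symm
    _ ≤ dist q.2 z.2 + dist z.2 0 := dist_triangle _ _ _
    _ = dist q.2 z.2 + ‖z.2‖ := by rw [dist_zero_right]
    _ < ‖z.2‖ + 2 - z.1 := by linarith

/-! ### A continuous representative near a regular point -/

/-- **A continuous representative near a regular point before the final time.** If `(w, π)` is
a suitable weak solution in every `Q(a)`, `a > 0` (property (𝒜)(i) of the blow-up limit) and
`z = (t, x)`, `t < 0`, is a regular point of `w` (`w` essentially bounded on some `Q*_{r₀}(z)`),
then for some `0 < R` with `R² ≤ -t` there is a function `v` continuous on the backward cylinder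
`Q((t + R²/2, x), R) ∋ z` with `w = v` a.e. there: the accepted interior regularity of
essentially bounded distributional solutions with `L_{3/2}` pressure
(`NSBoundedInteriorContinuity_holds`, Seregin–Šverák 2009 §2 p. 8) on that cylinder, which lies
in `Q*_{r₀}(z) ∩ Q(a)` for `a` large.
[cite: Seregin2020, proof of Thm 2.1, (2.12) ("spatial derivatives … Hölder continuous" off the singular set)] -/
theorem exists_continuousOn_repr_of_isRegularPoint
    {w : ℝ → EuclideanSpace ℝ (Fin 3) → EuclideanSpace ℝ (Fin 3)}
    {π : ℝ → EuclideanSpace ℝ (Fin 3) → ℝ}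
    (hw : ∀ a : ℝ, 0 < a → IsSuitableWeakSolutionInBall a 0 w π)
    {z : ℝ × EuclideanSpace ℝ (Fin 3)} (hz : z.1 < 0) (hreg : IsRegularPoint w z) :
    ∃ (R : ℝ) (v : ℝ × EuclideanSpace ℝ (Fin 3) → EuclideanSpace ℝ (Fin 3)), 0 < R ∧ R ^ 2 ≤ -z.1 ∧
      ContinuousOn v (parabolicCylinder R (z.1 + R ^ 2 / 2, z.2)) ∧
      uncurry w =ᵐ[volume.restrict (parabolicCylinder R (z.1 + R ^ 2 / 2, z.2))] v := by
  obtain ⟨r₀, hr₀, hbd₀⟩ := hreg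
  set R : ℝ := min (min r₀ 1) (-z.1) with hR
  have hR0 : 0 < R := lt_min (lt_min hr₀ one_pos) (by linarith)
  have hRr : R ≤ r₀ := (min_le_left _ _).trans (min_le_left _ _)
  have hR1 : R ≤ 1 := (min_le_left _ _).trans (min_le_right _ _)
  have hRt : R ≤ -z.1 := min_le_right _ _
  set c : ℝ × EuclideanSpace ℝ (Fin 3) := (z.1 + R ^ 2 / 2, z.2) with hc
  set a : ℝ := ‖z.2‖ + 2 - z.1 with ha
  have ha0 : 0 < a := by
    have := norm_nonneg z.2
    rw [ha]
    linarith
  have hCQ0 : parabolicCylinder R c ⊆ parabolicCylinderCentered r₀ z :=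
    parabolicCylinder_shifted_subset_centered hR0 hRr z
  have hCQa : parabolicCylinder R c ⊆ parabolicCylinder a (0 : ℝ × EuclideanSpace ℝ (Fin 3)) :=
    parabolicCylinder_shifted_subset_zero hR0 hR1 hRt
  obtain ⟨hsw, -, -, hπ⟩ := hw a ha0
  -- the equations on the small cylinder
  have hle : parabolicCylinderOpens R c ≤ parabolicCylinderOpens a (0 : ℝ × EuclideanSpace ℝ (Fin 3)) :=
    hCQa
  have hdist : IsDistributionalNSSolutionOn (parabolicCylinderOpens R c) 1 0 w π :=
    hsw.distributional.of_le hle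
  -- the essential bound on the small cylinder
  have hbd : eLpNorm (uncurry w) ∞ (volume.restrict (parabolicCylinder R c)) < ∞ :=
    (eLpNorm_mono_measure _ (Measure.restrict_mono hCQ0 le_rfl)).trans_lt hbd₀
  set M : ℝ := (eLpNorm (uncurry w) ∞ (volume.restrict (parabolicCylinder R c))).toReal with hM
  have hbdd : ∀ᵐ q ∂(volume.restrict (parabolicCylinder R c)), ‖w q.1 q.2‖ ≤ M := by
    filter_upwards [ae_le_eLpNormEssSup (μ := volume.restrict (parabolicCylinder R c))
      (f := uncurry w)] with q hq
    rw [← eLpNorm_exponent_top] at hq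
    have := ENNReal.toReal_mono hbd.ne hq
    rwa [toReal_enorm] at this
  -- the pressure is in `L_{3/2}` of the small cylinder
  have hpress : ∫⁻ q in parabolicCylinder R c, ‖π q.1 q.2‖ₑ ^ (3 / 2 : ℝ) < ∞ := by
    have h := lintegral_rpow_enorm_lt_top_of_eLpNorm_lt_top (by norm_num)
      (by simp [ENNReal.div_eq_top]) hπ.2
    have e32 : ((3 / 2 : ℝ≥0∞)).toReal = (3 / 2 : ℝ) := by
      rw [ENNReal.toReal_div]; norm_num
    have h' : ∫⁻ q in parabolicCylinder a (0 : ℝ × EuclideanSpace ℝ (Fin 3)),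
        ‖π q.1 q.2‖ₑ ^ (3 / 2 : ℝ) < ∞ := by
      simpa only [e32, uncurry] using h
    exact (lintegral_mono_set hCQa).trans_lt h'
  obtain ⟨v, hvc, hae⟩ := NSBoundedInteriorContinuity_holds w π c R M hdist hbdd hpress
  refine ⟨R, v, hR0, ?_, hvc, hae⟩
  nlinarith

/-! ### Pointwise axisymmetry of a continuous representative about an axis point -/

/-- Rotations about the axis fix the points of the axis. [folklore] -/
theorem rotZ_eq_self_of_cylRadius {x : EuclideanSpace ℝ (Fin 3)} (hx : cylRadius x = 0) (θ : ℝ) :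
    rotZ θ x = x := by
  obtain ⟨h0, h1⟩ := (cylRadius_eq_zero_iff x).1 hx
  ext i
  fin_cases i <;> simp [h0, h1]

/-- **Axial symmetry at every point of a continuous representative.** If every slice `w(s, ·)`
is axisymmetric and `v` is continuous on a backward cylinder `Q(c, R)` centred on the axis with
`w = v` a.e. there, then `v(s, R_θ y) = R_θ v(s, y)` at EVERY point of `Q(c, R)`: the space–time
rotation `(s, y) ↦ (s, R_θ y)` preserves Lebesgue measure and `Q(c, R)`, so both sides agree
a.e. on the open cylinder and are continuous there (`Measure.eqOn_open_of_ae_eq`).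
[cite: Seregin2020, proof of Thm 2.1, property (𝒜)(ii) of the limit] -/
theorem repr_rotZ_of_cylRadius_eq_zero {R : ℝ} {c : ℝ × EuclideanSpace ℝ (Fin 3)}
    (hc : cylRadius c.2 = 0)
    {v : ℝ × EuclideanSpace ℝ (Fin 3) → EuclideanSpace ℝ (Fin 3)}
    {w : ℝ → EuclideanSpace ℝ (Fin 3) → EuclideanSpace ℝ (Fin 3)}
    (hv : ContinuousOn v (parabolicCylinder R c))
    (hae : uncurry w =ᵐ[volume.restrict (parabolicCylinder R c)] v)
    (hax : ∀ s, IsAxisymmetric (w s)) (θ : ℝ) :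
    ∀ q ∈ parabolicCylinder R c, v (q.1, rotZ θ q.2) = rotZ θ (v q) := by
  -- the space–time rotation and its invariances
  set Φ : ℝ × EuclideanSpace ℝ (Fin 3) → ℝ × EuclideanSpace ℝ (Fin 3) :=
    fun q => (q.1, rotZ θ q.2) with hΦ
  have hrot : Continuous (rotZ θ) := (rotZLIE θ).continuous
  have hΦc : Continuous Φ := continuous_fst.prodMk (hrot.comp continuous_snd)
  have hdist : ∀ y : EuclideanSpace ℝ (Fin 3), dist (rotZ θ y) c.2 = dist y c.2 := by
    intro y
    have h := (rotZLIE θ).dist_map y c.2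
    rwa [rotZLIE_apply, rotZLIE_apply, rotZ_eq_self_of_cylRadius hc θ] at h
  have hpre : Φ ⁻¹' parabolicCylinder R c = parabolicCylinder R c := by
    ext q
    simp only [mem_preimage, hΦ, mem_parabolicCylinder, hdist]
  have hΦr : MeasurePreserving Φ (volume.restrict (parabolicCylinder R c))
      (volume.restrict (parabolicCylinder R c)) := by
    have h := (measurePreserving_rotST θ).restrict_preimage
      (isOpen_parabolicCylinder R c).measurableSet
    rwa [hpre] at h
  have hmaps : MapsTo Φ (parabolicCylinder R c) (parabolicCylinder R c) := by
    intro q hq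
    rw [← mem_preimage, hpre]
    exact hq
  -- `v ∘ Φ = R_θ ∘ v` almost everywhere on the cylinder
  have h1 : (v ∘ Φ) =ᵐ[volume.restrict (parabolicCylinder R c)] (uncurry w ∘ Φ) :=
    hΦr.quasiMeasurePreserving.ae_eq_comp hae.symm
  have h2 : (uncurry w ∘ Φ) = fun q => rotZ θ (uncurry w q) := by
    funext q
    simp only [comp_apply, hΦ, uncurry]
    exact hax q.1 θ q.2
  have h3 : (fun q => rotZ θ (uncurry w q)) =ᵐ[volume.restrict (parabolicCylinder R c)]
      fun q => rotZ θ (v q) := by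
    filter_upwards [hae] with q hq
    rw [hq]
  have hae' : (v ∘ Φ) =ᵐ[volume.restrict (parabolicCylinder R c)] fun q => rotZ θ (v q) := by
    rw [h2] at h1
    exact h1.trans h3
  -- both sides are continuous on the open cylinder, hence equal there
  have hc1 : ContinuousOn (v ∘ Φ) (parabolicCylinder R c) := hv.comp hΦc.continuousOn hmaps
  have hc2 : ContinuousOn (fun q => rotZ θ (v q)) (parabolicCylinder R c) :=
    hrot.comp_continuousOn hv
  have heq : EqOn (v ∘ Φ) (fun q => rotZ θ (v q)) (parabolicCylinder R c) :=
    Measure.eqOn_open_of_ae_eq hae' (isOpen_parabolicCylinder R c) hc1 hc2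
  intro q hq
  exact heq hq

/-! ### The swirl near a regular axis point -/

/-- **Seregin 2020, proof of Thm 2.1, (2.12): near a regular axis point the swirl is continuous
and vanishes on the axis.** Let `(w, π)` be a suitable weak solution in every `Q(a)`, `a > 0`,
with axisymmetric slices (properties (𝒜)(i)–(ii) of the blow-up limit), and let `z = (t, x)`
with `t < 0` and `x` on the axis be a regular point of `w`. Then on some centred cylinder
`Q*_r(z)`, `r > 0`, `w` has a representative `V` (`w = V` a.e. on `Q*_r(z)`) which is continuous
on `Q*_r(z)`, axisymmetric at every point of `Q*_r(z)` (`V(s, R_θ y) = R_θ V(s, y)`), whose swirl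
`Γ = swirl (V s) = y₀V₁ - y₁V₀` is continuous on `Q*_r(z)` and vanishes at the axis points of
`Q*_r(z)` ("`Γ(0, x₃, t) = 0` … `(0, x₃, t) ∉ S^Γ_t`"; (2.12) "`Γ(x, t) → 0` as `x' → 0`").
[cite: Seregin2020, proof of Thm 2.1, (2.12)] -/
theorem exists_axisymmetricRepr_of_isRegularPoint
    {w : ℝ → EuclideanSpace ℝ (Fin 3) → EuclideanSpace ℝ (Fin 3)}
    {π : ℝ → EuclideanSpace ℝ (Fin 3) → ℝ}
    (hw : ∀ a : ℝ, 0 < a → IsSuitableWeakSolutionInBall a 0 w π)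
    (hax : ∀ s, IsAxisymmetric (w s))
    {z : ℝ × EuclideanSpace ℝ (Fin 3)} (hz : z.1 < 0) (hzax : cylRadius z.2 = 0)
    (hreg : IsRegularPoint w z) :
    ∃ (V : ℝ → EuclideanSpace ℝ (Fin 3) → EuclideanSpace ℝ (Fin 3)) (r : ℝ), 0 < r ∧
      uncurry w =ᵐ[volume.restrict (parabolicCylinderCentered r z)] uncurry V ∧
      ContinuousOn (uncurry V) (parabolicCylinderCentered r z) ∧
      (∀ q ∈ parabolicCylinderCentered r z, ∀ θ : ℝ, V q.1 (rotZ θ q.2) = rotZ θ (V q.1 q.2)) ∧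
      ContinuousOn (fun q : ℝ × EuclideanSpace ℝ (Fin 3) => swirl (V q.1) q.2)
        (parabolicCylinderCentered r z) ∧
      ∀ q ∈ parabolicCylinderCentered r z, cylRadius q.2 = 0 → swirl (V q.1) q.2 = 0 := by
  obtain ⟨R, v, hR0, -, hvc, hae⟩ := exists_continuousOn_repr_of_isRegularPoint hw hz hreg
  have hsub : parabolicCylinderCentered (R / 2) z ⊆ parabolicCylinder R (z.1 + R ^ 2 / 2, z.2) :=
    parabolicCylinderCentered_half_subset_shifted hR0 z
  set V : ℝ → EuclideanSpace ℝ (Fin 3) → EuclideanSpace ℝ (Fin 3) := fun t x => v (t, x) with hV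
  have hVv : uncurry V = v := rfl
  have hvS : ContinuousOn v (parabolicCylinderCentered (R / 2) z) := hvc.mono hsub
  have hzax' : cylRadius ((z.1 + R ^ 2 / 2, z.2) : ℝ × EuclideanSpace ℝ (Fin 3)).2 = 0 := hzax
  refine ⟨V, R / 2, half_pos hR0, ?_, ?_, ?_, ?_, ?_⟩
  · rw [hVv]
    exact ae_restrict_of_ae_restrict_of_subset hsub hae
  · rw [hVv]
    exact hvS
  · intro q hq θ
    exact repr_rotZ_of_cylRadius_eq_zero hzax' hvc hae hax θ q (hsub hq)
  · have hc0 : Continuous fun x : EuclideanSpace ℝ (Fin 3) => x 0 := by fun_prop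
    have hc1 : Continuous fun x : EuclideanSpace ℝ (Fin 3) => x 1 := by fun_prop
    have hv0 : ContinuousOn (fun q => v q 0) (parabolicCylinderCentered (R / 2) z) :=
      hc0.comp_continuousOn hvS
    have hv1 : ContinuousOn (fun q => v q 1) (parabolicCylinderCentered (R / 2) z) :=
      hc1.comp_continuousOn hvS
    have hq0 : ContinuousOn (fun q : ℝ × EuclideanSpace ℝ (Fin 3) => q.2 0)
        (parabolicCylinderCentered (R / 2) z) := (hc0.comp continuous_snd).continuousOn
    have hq1 : ContinuousOn (fun q : ℝ × EuclideanSpace ℝ (Fin 3) => q.2 1)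
        (parabolicCylinderCentered (R / 2) z) := (hc1.comp continuous_snd).continuousOn
    have e : (fun q : ℝ × EuclideanSpace ℝ (Fin 3) => swirl (V q.1) q.2) =
        fun q => q.2 0 * v q 1 - q.2 1 * v q 0 := rfl
    rw [e]
    exact (hq0.mul hv1).sub (hq1.mul hv0)
  · intro q _ hq
    exact swirl_eq_zero_of_cylRadius_eq_zero _ hq

/-! ### The registered sub-stub -/

/-- **Sub-stub `swirl_continuous_zero_at_regular_axis_point` of the crux `AxisymmetricKatoGlobal`**
(toward `stub_seregin2020TypeII`, Seregin 2020 Thm 2.1, (2.12) and "`Γ(0, x₃, t) = 0` off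
`S^Γ_t`" for the blow-up limit): for a suitable weak solution `(w, π)` in every `Q(a)` with
axisymmetric slices and a regular point `z = (t, x)`, `t < 0`, `x` on the axis, there are `V`
and `r > 0` with `w = V` a.e. on `Q*_r(z)`, `swirl V` continuous on `Q*_r(z)` and `= 0` at its
axis points (from `exists_axisymmetricRepr_of_isRegularPoint`, which also records the
continuity and the pointwise axisymmetry of `V`). [cite: Seregin2020, proof of Thm 2.1, (2.12)] -/
theorem swirl_continuous_zero_at_regular_axis_point :
    ∀ (w : ℝ → EuclideanSpace ℝ (Fin 3) → EuclideanSpace ℝ (Fin 3))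
      (π : ℝ → EuclideanSpace ℝ (Fin 3) → ℝ),
      (∀ a : ℝ, 0 < a → IsSuitableWeakSolutionInBall a 0 w π) →
      (∀ s, IsAxisymmetric (w s)) →
      ∀ z : ℝ × EuclideanSpace ℝ (Fin 3), z.1 < 0 → cylRadius z.2 = 0 → IsRegularPoint w z →
        ∃ (V : ℝ → EuclideanSpace ℝ (Fin 3) → EuclideanSpace ℝ (Fin 3)) (r : ℝ), 0 < r ∧
          uncurry w =ᵐ[volume.restrict (parabolicCylinderCentered r z)] uncurry V ∧
          ContinuousOn (fun q : ℝ × EuclideanSpace ℝ (Fin 3) => swirl (V q.1) q.2)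
            (parabolicCylinderCentered r z) ∧
          ∀ q ∈ parabolicCylinderCentered r z, cylRadius q.2 = 0 → swirl (V q.1) q.2 = 0 := by
  intro w π hw hax z hz hzax hreg
  obtain ⟨V, r, hr, hae, -, -, hsw, h0⟩ := exists_axisymmetricRepr_of_isRegularPoint hw hax hz hzax hreg
  exact ⟨V, r, hr, hae, hsw, h0⟩

end Summit.NavierStokesRegularity.NavierStokesRegularity.Theorems.AxisymmetricKatoGlobal.EulerScaling

end
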